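import Summits.Parity.GeneralizedHardyLittlewood.Theorems.ModelHyperbolicity.Negative.ModelHyperbolicityNotMonotone

/-!
# `ModelHyperbolicity` (stmt-Parity-14110): the threshold at `u = 4` — `x = 480` fails, `x = 481` holds

Part 5 of the cdisprove seat's lemmas (kernel-clean, no `native_decide`; the raw cells take about 40 s
each to elaborate: 480-term unrolling with the `Nat.minFac` norm_num extension and the
`Nat.primeFactorsList_ofNat` simproc). Window `4⁴ ≤ x < 5⁴`: rough = `P⁻(n) ≥ 5`;
`(A₁,A₂,A₃)(480) = (90,59,10)`, `(481) = (90,60,10)` (`481 = 13·37`). So `Q_{4,480} = 90 + 59t + 10t²`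
has discriminant `−119` (`not_realRootedAt_four_480`) while `Q_{4,481} = 10(t+3)²` (`realRootedAt_four_481`, a DOUBLE zero —
no strict sign-alternation certificate exists there): `threshold_four`. gen-1's exact sweep to `2·10⁶`
found no failure beyond `480` at `u = 4` (`x₀(4) = 481`), and `x₀(5,6,7) = 7^u`. [folklore]
-/

namespace Summit.Parity.GeneralizedHardyLittlewood.Theorems.ModelHyperbolicity.Negative

open Summit.Parity.GeneralizedHardyLittlewood.Theses.LeeYangFibres
open Finset Polynomial
open scoped Classical

/-! ### (B2) the threshold at `u = 4`: `x = 480` fails, `x = 481` holds with a DOUBLE zero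
(gen-1: `x₀(4) = 481` exactly by an exact sweep to `2·10⁶`; here kernel-clean, no `native_decide`).
Window `4⁴ = 256 ≤ x < 625 = 5⁴`: rough = `P⁻(n) ≥ 5`. Cells `(A₁,A₂,A₃)(480) = (90,59,10)`,
`(481) = (90,60,10)` (`481 = 13·37`): `Q_{4,480} = 90 + 59t + 10t²` (`40·Q = (20t+59)² + 119 > 0` on ℝ),
`Q_{4,481} = 10(t+3)²`. -/

set_option maxRecDepth 8000 in
set_option maxHeartbeats 800000 in
/-- Raw window cell `A₁(480) = 90` (`B = 5`; about 40 s on the farm: 480-term unrolling). -/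
theorem wcell_480_1 :
    ((Finset.Icc 1 480).filter (fun n => 5 ≤ Nat.minFac n ∧ ArithmeticFunction.cardFactors n = 1)).card = 90 := by
  rw [Finset.card_filter]
  simp [Finset.sum_Icc_succ_top, ArithmeticFunction.cardFactors_apply, Nat.primeFactorsList_ofNat]
  norm_num

set_option maxRecDepth 8000 in
set_option maxHeartbeats 800000 in
/-- Raw window cell `A₂(480) = 59`. -/
theorem wcell_480_2 :
    ((Finset.Icc 1 480).filter (fun n => 5 ≤ Nat.minFac n ∧ ArithmeticFunction.cardFactors n = 2)).card = 59 := by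
  rw [Finset.card_filter]
  simp [Finset.sum_Icc_succ_top, ArithmeticFunction.cardFactors_apply, Nat.primeFactorsList_ofNat]
  norm_num

set_option maxRecDepth 8000 in
set_option maxHeartbeats 800000 in
/-- Raw window cell `A₃(480) = 10` (`125,175,245,275,325,343,385,425,455,475`). -/
theorem wcell_480_3 :
    ((Finset.Icc 1 480).filter (fun n => 5 ≤ Nat.minFac n ∧ ArithmeticFunction.cardFactors n = 3)).card = 10 := by
  rw [Finset.card_filter]
  simp [Finset.sum_Icc_succ_top, ArithmeticFunction.cardFactors_apply, Nat.primeFactorsList_ofNat]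
  norm_num
/-- The three raw window cells at `x = 480`. -/

theorem wcells_480 :
    ((Finset.Icc 1 480).filter (fun n => 5 ≤ Nat.minFac n ∧ ArithmeticFunction.cardFactors n = 1)).card = 90 ∧
    ((Finset.Icc 1 480).filter (fun n => 5 ≤ Nat.minFac n ∧ ArithmeticFunction.cardFactors n = 2)).card = 59 ∧
    ((Finset.Icc 1 480).filter (fun n => 5 ≤ Nat.minFac n ∧ ArithmeticFunction.cardFactors n = 3)).card = 10 :=
  ⟨wcell_480_1, wcell_480_2, wcell_480_3⟩

/-- Raw window cells at `x = 481 = 13·37`: only `A₂` moves. -/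
theorem wcells_481 :
    ((Finset.Icc 1 481).filter (fun n => 5 ≤ Nat.minFac n ∧ ArithmeticFunction.cardFactors n = 1)).card = 90 ∧
    ((Finset.Icc 1 481).filter (fun n => 5 ≤ Nat.minFac n ∧ ArithmeticFunction.cardFactors n = 2)).card = 60 ∧
    ((Finset.Icc 1 481).filter (fun n => 5 ≤ Nat.minFac n ∧ ArithmeticFunction.cardFactors n = 3)).card = 10 := by
  obtain ⟨h1, h2, h3⟩ := wcells_480
  rw [Finset.card_filter] at h1 h2 h3
  refine ⟨?_, ?_, ?_⟩
  · rw [Finset.card_filter, Finset.sum_Icc_succ_top (by norm_num : 1 ≤ 481), h1]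
    simp [ArithmeticFunction.cardFactors_apply, Nat.primeFactorsList_ofNat]
  · rw [Finset.card_filter, Finset.sum_Icc_succ_top (by norm_num : 1 ≤ 481), h2]
    simp [ArithmeticFunction.cardFactors_apply, Nat.primeFactorsList_ofNat]
    norm_num
  · rw [Finset.card_filter, Finset.sum_Icc_succ_top (by norm_num : 1 ≤ 481), h3]
    simp [ArithmeticFunction.cardFactors_apply, Nat.primeFactorsList_ofNat]
/-- Cells `(A₁,A₂,A₃)(480) = (90,59,10)` at `u = 4`. -/

theorem cells_four_480 : cell 4 480 1 = 90 ∧ cell 4 480 2 = 59 ∧ cell 4 480 3 = 10 := by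
  have h : ∀ j, cell 4 480 j = ((Finset.Icc 1 480).filter (fun n => 5 ≤ Nat.minFac n ∧
      ArithmeticFunction.cardFactors n = j)).card :=
    cell_eq_of_window (B := 5) (by norm_num) (by norm_num) (by norm_num)
  simp only [h]
  exact wcells_480
/-- Cells `(A₁,A₂,A₃)(481) = (90,60,10)` at `u = 4`. -/

theorem cells_four_481 : cell 4 481 1 = 90 ∧ cell 4 481 2 = 60 ∧ cell 4 481 3 = 10 := by
  have h : ∀ j, cell 4 481 j = ((Finset.Icc 1 481).filter (fun n => 5 ≤ Nat.minFac n ∧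
      ArithmeticFunction.cardFactors n = j)).card :=
    cell_eq_of_window (B := 5) (by norm_num) (by norm_num) (by norm_num)
  simp only [h]
  exact wcells_481

/-- `P_{4,480}(z) = z(90 + 59z + 10z²)` has the non-real pair `(−59 ± i√119)/20`: `x₀(4) ≥ 481`. -/
theorem not_realRootedAt_four_480 : ¬ RealRootedAt 4 480 := by
  obtain ⟨h1, h2, h3⟩ := cells_four_480
  intro h
  obtain ⟨z, hz⟩ : ∃ z : ℂ, 10 * z ^ 2 + 59 * z + 90 = 0 := by
    obtain ⟨z, hz⟩ := IsAlgClosed.exists_root (C 10 * X ^ 2 + C 59 * X + C 90 : ℂ[X])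
      (by rw [Polynomial.degree_quadratic (by norm_num)]; norm_num)
    exact ⟨z, by simpa [IsRoot] using hz⟩
  have hP : cellPoly 4 480 z = 90 * z + 59 * z ^ 2 + 10 * z ^ 3 := by
    simp [cellPoly, Finset.sum_range_succ, cell_zero, h1, h2, h3,
      cell_eq_zero_of_le (u := 4) (x := 480) (j := 4) (by norm_num) (by norm_num)]
  have him : z.im = 0 := h z (by rw [hP]; linear_combination z * hz)
  have hre : (z.re : ℂ) = z := Complex.ext rfl (by simp [him])
  rw [← hre] at hz
  norm_cast at hz
  nlinarith [sq_nonneg (20 * z.re + 59)]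

/-- `P_{4,481}(z) = 10 z (z+3)²`: real-rooted, with a DOUBLE zero (so no strict sign-alternation
certificate exists at `x = 481`; the transfer lemma is not the only way in). -/
theorem realRootedAt_four_481 : RealRootedAt 4 481 := by
  obtain ⟨h1, h2, h3⟩ := cells_four_481
  intro z hz
  have hP : cellPoly 4 481 z = 10 * z * (z + 3) ^ 2 := by
    simp [cellPoly, Finset.sum_range_succ, cell_zero, h1, h2, h3,
      cell_eq_zero_of_le (u := 4) (x := 481) (j := 4) (by norm_num) (by norm_num)]
    ring
  rw [hP] at hz
  rcases mul_eq_zero.mp hz with hz0 | hz3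
  · rcases mul_eq_zero.mp hz0 with h10 | rfl
    · norm_num at h10
    · simp
  · have : z = -3 := by
      have := pow_eq_zero_iff (n := 2) (by norm_num) |>.mp hz3
      linear_combination this
    rw [this]
    norm_num

/-- `x₀(4) ≥ 481` and `481` itself is fine: the pair `(480, 481)` brackets the observed threshold. -/
theorem threshold_four : ¬ RealRootedAt 4 480 ∧ RealRootedAt 4 481 :=
  ⟨not_realRootedAt_four_480, realRootedAt_four_481⟩



end Summit.Parity.GeneralizedHardyLittlewood.Theorems.ModelHyperbolicity.Negative
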